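import Literature.Barriers.CriticalPhenomena.LaceExpansionXSpaceWeightInsertion
import HarnessLib

/-!
# Marks at given positions, the double weight insertion (both paths), and the diagram of `Π^{(N+1)}`
# at `p_c` with the readers of its two paths (Hara 2008, §3.4, Steps 1 and 3) — PROVED

Barrier catalogue `Literature/Barriers/CriticalPhenomena/` (D-0021). Seventh layer under
`Hara2008_weightedNLoopBoundPc` (`LaceExpansionXSpaceLemma16.lean`). `LaceExpansionXSpaceWeightInsertion.lean`
pushes ONE weight `|φ_M - o|^b` onto the lines of a chain (Hara's Step 1 for one path); here this is done for
BOTH paths ("Suppose for concreteness that `|x|^β` is on the upper line, and `|x|^γ` is on the lower line") and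
specialised to the Hara–Slade diagram of `Π^{(N+1)}` written as the chain `δ₀ · A₃-start · B₁B₂⋯B₁ · A₃-end`
(`tsum_mul_piNDiagramPc_succ_eq`), each kernel now carrying the readers of the positions of the two paths
after it (the paths interchange coordinates after every `B₂`, Heydenreich–van der Hofstad §7.5.2). PROVED:

* `markAt` (mark the `j`-th kernel of a reader-bundled list), `markedSum_eq_sum` (the one-mark sum of the
  previous layer is `Σ_j` over the marked position), `markAt₁`, `toΦ`, `toΨ`, `dmChain d b c φ₀ ψ₀ Ts j l e`
  (kernel `j` weighted `|·|^b` along `P₁`, kernel `l` weighted `|·|^c` along `P₂`; `j = l` allowed);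
* `tsum_pkChainL_two_weights_le` — **double insertion**: `Σ_p (δ₀X₁⋯X_M)(p) e(p) |φ_M(p)|^b |ψ_M(p)|^c
  ≤ K_b(M) K_c(M) [ |0|^b|0|^c Σ(unmarked) + |0|^b Σ_l (l only) + |0|^c Σ_j (j only) + Σ_{j,l} dm(j,l) ]`;
* the master list `masterT d n` (`startT`, units `unitT`/`blocksFrom` with parity-dependent readers, `finalT`,
  `endT`), `kernelsOf_masterT` (its kernels are `kStartW :: kFine ++ [kEndW]`), `length_masterT = 2n+3`;
* `tsum_wE_wE_piNDiagramPc_succ_le` — **the doubly weighted diagram is dominated by the doubly marked chains**: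
  `Σ_x |x|^b|x|^c [diagram of Π^{(n+1)}](x) ≤ K_b(2n+3) K_c(2n+3) [four groups of marked chains]`
  ("The number of choices of 'long' segments are bounded by `(2N+1)²`", with `2N+1 = 2n+3`).

Not here (next layer): the bound of each marked chain by Hara's suprema (Step 2 on the chains, using the piece
estimates of `LaceExpansionXSpaceWeightedPieces.lean` / `LaceExpansionXSpaceHPiece.lean` and the three-factor
estimate) and the assembly of Step 3.

## References

* T. Hara, Ann. Probab. 36 (2008) 530–593 (arXiv:math-ph/0504021): §3.4 (Steps 1 and 3).
* M. Heydenreich, R. van der Hofstad, *Progress in High-Dimensional Percolation and Random Graphs*,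
  Springer 2017: (7.4.10), (7.5.5), §7.5.2 (the interchange of top and bottom after every `B₂`).
-/

noncomputable section

namespace Literature.Barriers.CriticalPhenomena

open _root_.MeasureTheory _root_.Filter Literature.Probability.LatticeModels
  Literature.Probability.Percolation

open scoped ENNReal

/-! ### Marks at given positions and the double weight insertion -/

section Marks

variable {d : ℕ}

/-- The list with the line of its `j`-th kernel weighted (readers unchanged; the previous reader of
the head is `φ'`). [cite: Hara2008, §3.4 (Step 1)] -/
def markAt (b : ℝ) : (Site d × Site d → Site d) → ℕ →
    List ((Site d × Site d → Site d × Site d → ℝ≥0∞) × (Site d × Site d → Site d)) →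
    List ((Site d × Site d → Site d × Site d → ℝ≥0∞) × (Site d × Site d → Site d))
  | _, _, [] => []
  | φ', 0, x :: Xs => (markK b φ' x.2 x.1, x.2) :: Xs
  | _, j + 1, x :: Xs => x :: markAt b x.2 j Xs

/-- Marking does not change the length. [folklore] -/
theorem length_markAt (b : ℝ) (φ' : Site d × Site d → Site d) (j : ℕ)
    (Xs : List ((Site d × Site d → Site d × Site d → ℝ≥0∞) × (Site d × Site d → Site d))) :
    (markAt b φ' j Xs).length = Xs.length := by
  induction Xs generalizing φ' j with
  | nil => cases j <;> rfl
  | cons x Xs ih => cases j with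
    | zero => rfl
    | succ j => simp [markAt, ih]

/-- Marking does not change the readers, hence not the last reader. [folklore] -/
theorem lastReader_markAt (b : ℝ) (φ₀ φ' : Site d × Site d → Site d) (j : ℕ)
    (Xs : List ((Site d × Site d → Site d × Site d → ℝ≥0∞) × (Site d × Site d → Site d))) :
    lastReader φ₀ (markAt b φ' j Xs) = lastReader φ₀ Xs := by
  induction Xs generalizing φ₀ φ' j with
  | nil => cases j <;> rfl
  | cons x Xs ih => cases j with
    | zero => rfl
    | succ j => simp only [markAt, lastReader_cons, ih]

/-- **The one-mark sum is the sum over the marked position.** [cite: Hara2008, §3.4 (Step 1: "Various choices of these elements")] -/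
theorem markedSum_eq_sum (b : ℝ) (v : Site d × Site d → ℝ≥0∞) (φ' : Site d × Site d → Site d)
    (Xs : List ((Site d × Site d → Site d × Site d → ℝ≥0∞) × (Site d × Site d → Site d)))
    (e : Site d × Site d → ℝ≥0∞) :
    markedSum b v φ' Xs e =
      ∑ j ∈ Finset.range Xs.length, ∑' p, pkChainL v (kernelsOf (markAt b φ' j Xs)) p * e p := by
  induction Xs generalizing v φ' with
  | nil => rfl
  | cons x Xs ih =>
    rw [List.length_cons, Finset.sum_range_succ', add_comm]
    show (∑' p, pkChainL (pkVmul v (markK b φ' x.2 x.1)) (kernelsOf Xs) p * e p) +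
        markedSum b (pkVmul v x.1) x.2 Xs e = _
    rw [ih]
    rfl

/-- The `Φ`-view (kernel with the reader of path `P₁`) of a kernel carrying two readers. [folklore] -/
def toΦ (x : (Site d × Site d → Site d × Site d → ℝ≥0∞) × (Site d × Site d → Site d) × (Site d × Site d → Site d)) :
    (Site d × Site d → Site d × Site d → ℝ≥0∞) × (Site d × Site d → Site d) := (x.1, x.2.1)

/-- The `Ψ`-view (kernel with the reader of path `P₂`). [folklore] -/
def toΨ (x : (Site d × Site d → Site d × Site d → ℝ≥0∞) × (Site d × Site d → Site d) × (Site d × Site d → Site d)) :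
    (Site d × Site d → Site d × Site d → ℝ≥0∞) × (Site d × Site d → Site d) := (x.1, x.2.2)

/-- Marking the `j`-th kernel along path `P₁` of a list of kernels with two readers. [cite: Hara2008, §3.4 (Step 1)] -/
def markAt₁ (b : ℝ) : (Site d × Site d → Site d) → ℕ →
    List ((Site d × Site d → Site d × Site d → ℝ≥0∞) × (Site d × Site d → Site d) × (Site d × Site d → Site d)) →
    List ((Site d × Site d → Site d × Site d → ℝ≥0∞) × (Site d × Site d → Site d) × (Site d × Site d → Site d))
  | _, _, [] => []
  | φ', 0, x :: Ts => (markK b φ' x.2.1 x.1, x.2) :: Ts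
  | _, j + 1, x :: Ts => x :: markAt₁ b x.2.1 j Ts

/-- The `Φ`-view of `markAt₁` is `markAt` of the `Φ`-view. [folklore] -/
theorem map_toΦ_markAt₁ (b : ℝ) (φ' : Site d × Site d → Site d) (j : ℕ)
    (Ts : List ((Site d × Site d → Site d × Site d → ℝ≥0∞) × (Site d × Site d → Site d) × (Site d × Site d → Site d))) :
    (markAt₁ b φ' j Ts).map toΦ = markAt b φ' j (Ts.map toΦ) := by
  induction Ts generalizing φ' j with
  | nil => cases j <;> rfl
  | cons x Ts ih => cases j with
    | zero => rfl
    | succ j => simp only [markAt₁, List.map_cons, markAt, ih]; rfl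

/-- The kernels of the two views coincide. [folklore] -/
theorem kernelsOf_map_toΦ_eq
    (Ts : List ((Site d × Site d → Site d × Site d → ℝ≥0∞) × (Site d × Site d → Site d) × (Site d × Site d → Site d))) :
    kernelsOf (Ts.map toΦ) = kernelsOf (Ts.map toΨ) := by
  simp [kernelsOf, toΦ, toΨ, Function.comp_def]

/-- Marking along `P₁` does not change the `Ψ`-readers. [folklore] -/
theorem lastReader_map_toΨ_markAt₁ (b : ℝ) (ψ₀ φ' : Site d × Site d → Site d) (j : ℕ)
    (Ts : List ((Site d × Site d → Site d × Site d → ℝ≥0∞) × (Site d × Site d → Site d) × (Site d × Site d → Site d))) :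
    lastReader ψ₀ ((markAt₁ b φ' j Ts).map toΨ) = lastReader ψ₀ (Ts.map toΨ) := by
  induction Ts generalizing ψ₀ φ' j with
  | nil => cases j <;> rfl
  | cons x Ts ih => cases j with
    | zero => rfl
    | succ j => simp only [markAt₁, List.map_cons, lastReader_cons, ih]

/-- Marking does not change the length of the `Ψ`-view. [folklore] -/
theorem length_map_toΨ_markAt₁ (b : ℝ) (φ' : Site d × Site d → Site d) (j : ℕ)
    (Ts : List ((Site d × Site d → Site d × Site d → ℝ≥0∞) × (Site d × Site d → Site d) × (Site d × Site d → Site d))) :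
    ((markAt₁ b φ' j Ts).map toΨ).length = Ts.length := by
  rw [List.length_map]
  induction Ts generalizing φ' j with
  | nil => cases j <;> rfl
  | cons x Ts ih => cases j with
    | zero => rfl
    | succ j => simp [markAt₁, ih]

/-- **The doubly marked chain**: kernel `j` weighted `|·|^b` along `P₁`, kernel `l` weighted `|·|^c` along
`P₂` (`j = l` allowed: both lines of one kernel), from the point mass at `(0,0)`.
[cite: Hara2008, §3.4 (Step 1: "long segments … on the upper and lower lines")] -/
def dmChain (d : ℕ) (b c : ℝ) (φ₀ ψ₀ : Site d × Site d → Site d)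
    (Ts : List ((Site d × Site d → Site d × Site d → ℝ≥0∞) × (Site d × Site d → Site d) × (Site d × Site d → Site d)))
    (j l : ℕ) (e : Site d × Site d → ℝ≥0∞) : ℝ≥0∞ :=
  ∑' p, pkChainL (vDelta d) (kernelsOf (markAt c ψ₀ l ((markAt₁ b φ₀ j Ts).map toΨ))) p * e p

/-- Scalars pass through left chains. [folklore] -/
theorem pkChainL_const_mul {α : Type*} (k : ℝ≥0∞) (v : α × α → ℝ≥0∞) (Xs : List (α × α → α × α → ℝ≥0∞)) :
    pkChainL (fun p => k * v p) Xs = fun p => k * pkChainL v Xs p := by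
  induction Xs generalizing v with
  | nil => rfl
  | cons X Xs ih =>
    rw [pkChainL_cons, pkChainL_cons]
    have h : pkVmul (fun p => k * v p) X = fun p => k * pkVmul v X p := by
      funext q
      simp only [pkVmul, ← ENNReal.tsum_mul_left, mul_assoc]
    rw [h, ih]

/-- The start weight at the point mass is `|0|^b`. [folklore] -/
theorem vDelta_mul_wE (b : ℝ) (φ₀ : Site d × Site d → Site d) (hφ₀ : φ₀ (0, 0) = 0) :
    (fun p => vDelta d p * wE b (φ₀ p - 0)) = fun p => wE b (0 : Site d) * vDelta d p := by
  funext p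
  by_cases hp : p = (0, 0)
  · rw [hp, hφ₀, sub_zero, mul_comm]
  · simp [vDelta, hp]

/-- **Double weight insertion** (Step 1 for both paths at once): with `M` kernels carrying readers
`φ` (path `P₁`, weight `b`) and `ψ` (path `P₂`, weight `c`), starting from the point mass at `(0,0)`
where both paths start at `0`,
`Σ_p (δ₀X₁⋯X_M)(p) e(p) |φ_M(p)|^b |ψ_M(p)|^c ≤ K_b(M) K_c(M) [ |0|^b|0|^c Σ_p(δ₀X₁⋯X_M)(p)e(p)
  + |0|^b Σ_l dm(l only) + |0|^c Σ_j dm(j only) + Σ_{j,l} dm(j,l) ]`.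
[cite: Hara2008, §3.4 (Steps 1 and 3: "(2N+1)^{β+γ}", "the number of choices … (2N+1)²")] -/
theorem tsum_pkChainL_two_weights_le {b c : ℝ} (hb : 0 ≤ b) (hc : 0 ≤ c)
    (φ₀ ψ₀ : Site d × Site d → Site d) (hφ₀ : φ₀ (0, 0) = 0) (hψ₀ : ψ₀ (0, 0) = 0)
    (Ts : List ((Site d × Site d → Site d × Site d → ℝ≥0∞) × (Site d × Site d → Site d) × (Site d × Site d → Site d)))
    (e : Site d × Site d → ℝ≥0∞) :
    ∑' p, pkChainL (vDelta d) (kernelsOf (Ts.map toΦ)) p *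
        (e p * (wE b (lastReader φ₀ (Ts.map toΦ) p - 0) * wE c (lastReader ψ₀ (Ts.map toΨ) p - 0))) ≤
      jK b Ts.length * jK c Ts.length *
        (wE b (0 : Site d) * wE c (0 : Site d) * ∑' p, pkChainL (vDelta d) (kernelsOf (Ts.map toΦ)) p * e p +
          wE b (0 : Site d) * ∑ l ∈ Finset.range Ts.length,
            ∑' p, pkChainL (vDelta d) (kernelsOf (markAt c ψ₀ l (Ts.map toΨ))) p * e p +
          wE c (0 : Site d) * ∑ j ∈ Finset.range Ts.length,
            ∑' p, pkChainL (vDelta d) (kernelsOf ((markAt₁ b φ₀ j Ts).map toΨ)) p * e p +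
          ∑ j ∈ Finset.range Ts.length, ∑ l ∈ Finset.range Ts.length, dmChain d b c φ₀ ψ₀ Ts j l e) := by
  -- the end vector after the `c`-weight
  let eγ : Site d × Site d → ℝ≥0∞ := fun p => e p * wE c (lastReader ψ₀ (Ts.map toΨ) p - 0)
  -- Step 1: the weight `b` along `P₁`
  have h1 : ∑' p, pkChainL (vDelta d) (kernelsOf (Ts.map toΦ)) p * (eγ p * wE b (lastReader φ₀ (Ts.map toΦ) p - 0)) ≤
      jK b Ts.length * (wE b (0 : Site d) * ∑' p, pkChainL (vDelta d) (kernelsOf (Ts.map toΦ)) p * eγ p +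
        ∑ j ∈ Finset.range Ts.length, ∑' p, pkChainL (vDelta d) (kernelsOf (markAt b φ₀ j (Ts.map toΦ))) p * eγ p) := by
    have h := tsum_pkChainL_weight_le hb (vDelta d) φ₀ 0 (Ts.map toΦ) eγ
    rw [List.length_map, vDelta_mul_wE b φ₀ hφ₀, pkChainL_const_mul, markedSum_eq_sum, List.length_map] at h
    refine h.trans (le_of_eq ?_)
    congr 2
    simp only [mul_assoc, ENNReal.tsum_mul_left]
  -- Step 2: the weight `c` along `P₂`, on the unmarked chain …
  have h2 : ∑' p, pkChainL (vDelta d) (kernelsOf (Ts.map toΦ)) p * eγ p ≤ jK c Ts.length *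
      (wE c (0 : Site d) * ∑' p, pkChainL (vDelta d) (kernelsOf (Ts.map toΦ)) p * e p +
        ∑ l ∈ Finset.range Ts.length, ∑' p, pkChainL (vDelta d) (kernelsOf (markAt c ψ₀ l (Ts.map toΨ))) p * e p) := by
    have h := tsum_pkChainL_weight_le hc (vDelta d) ψ₀ 0 (Ts.map toΨ) e
    rw [List.length_map, vDelta_mul_wE c ψ₀ hψ₀, pkChainL_const_mul, markedSum_eq_sum, List.length_map,
      ← kernelsOf_map_toΦ_eq] at h
    refine h.trans (le_of_eq ?_)
    congr 2
    simp only [mul_assoc, ENNReal.tsum_mul_left]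
  -- … and on each `b`-marked chain
  have h3 : ∀ j, ∑' p, pkChainL (vDelta d) (kernelsOf (markAt b φ₀ j (Ts.map toΦ))) p * eγ p ≤ jK c Ts.length *
      (wE c (0 : Site d) * ∑' p, pkChainL (vDelta d) (kernelsOf ((markAt₁ b φ₀ j Ts).map toΨ)) p * e p +
        ∑ l ∈ Finset.range Ts.length, dmChain d b c φ₀ ψ₀ Ts j l e) := by
    intro j
    have h := tsum_pkChainL_weight_le hc (vDelta d) ψ₀ 0 ((markAt₁ b φ₀ j Ts).map toΨ) e
    rw [length_map_toΨ_markAt₁, vDelta_mul_wE c ψ₀ hψ₀, pkChainL_const_mul, markedSum_eq_sum,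
      length_map_toΨ_markAt₁, lastReader_map_toΨ_markAt₁] at h
    rw [← map_toΦ_markAt₁, kernelsOf_map_toΦ_eq]
    refine h.trans (le_of_eq ?_)
    congr 2
    · simp only [mul_assoc, ENNReal.tsum_mul_left]
  -- assemble
  have hsum : ∑ j ∈ Finset.range Ts.length, jK c Ts.length *
      (wE c (0 : Site d) * ∑' p, pkChainL (vDelta d) (kernelsOf ((markAt₁ b φ₀ j Ts).map toΨ)) p * e p +
        ∑ l ∈ Finset.range Ts.length, dmChain d b c φ₀ ψ₀ Ts j l e) =
      jK c Ts.length * (wE c (0 : Site d) * ∑ j ∈ Finset.range Ts.length,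
        ∑' p, pkChainL (vDelta d) (kernelsOf ((markAt₁ b φ₀ j Ts).map toΨ)) p * e p +
        ∑ j ∈ Finset.range Ts.length, ∑ l ∈ Finset.range Ts.length, dmChain d b c φ₀ ψ₀ Ts j l e) := by
    rw [← Finset.mul_sum, Finset.sum_add_distrib, ← Finset.mul_sum]
  calc ∑' p, pkChainL (vDelta d) (kernelsOf (Ts.map toΦ)) p *
        (e p * (wE b (lastReader φ₀ (Ts.map toΦ) p - 0) * wE c (lastReader ψ₀ (Ts.map toΨ) p - 0)))
      = ∑' p, pkChainL (vDelta d) (kernelsOf (Ts.map toΦ)) p * (eγ p * wE b (lastReader φ₀ (Ts.map toΦ) p - 0)) := by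
        refine tsum_congr fun p => ?_
        simp only [eγ]
        ring
    _ ≤ jK b Ts.length * (wE b (0 : Site d) * ∑' p, pkChainL (vDelta d) (kernelsOf (Ts.map toΦ)) p * eγ p +
          ∑ j ∈ Finset.range Ts.length, ∑' p, pkChainL (vDelta d) (kernelsOf (markAt b φ₀ j (Ts.map toΦ))) p * eγ p) := h1
    _ ≤ jK b Ts.length * (wE b (0 : Site d) * (jK c Ts.length *
          (wE c (0 : Site d) * ∑' p, pkChainL (vDelta d) (kernelsOf (Ts.map toΦ)) p * e p +
            ∑ l ∈ Finset.range Ts.length, ∑' p, pkChainL (vDelta d) (kernelsOf (markAt c ψ₀ l (Ts.map toΨ))) p * e p)) +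
          ∑ j ∈ Finset.range Ts.length, jK c Ts.length *
            (wE c (0 : Site d) * ∑' p, pkChainL (vDelta d) (kernelsOf ((markAt₁ b φ₀ j Ts).map toΨ)) p * e p +
              ∑ l ∈ Finset.range Ts.length, dmChain d b c φ₀ ψ₀ Ts j l e)) :=
        mul_le_mul' le_rfl (add_le_add (mul_le_mul' le_rfl h2) (Finset.sum_le_sum fun j _ => h3 j))
    _ = _ := by
        rw [hsum]
        ring

end Marks

/-! ### The diagram of `Π^{(N+1)}` with the readers of its two paths -/

section Master

variable {d : ℕ}

/-- Reader of the first coordinate of a pair. [folklore] -/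
def rd1 (p : Site d × Site d) : Site d := p.1

/-- Reader of the second coordinate of a pair. [folklore] -/
def rd2 (p : Site d × Site d) : Site d := p.2

/-- One unit `B₁, B₂` of the diagram with the readers of the two paths after each kernel: in an odd
unit path `P₁` runs along the first coordinates (`w → z` on the `τ`-line of `B₁`, then `z → u'` in `B₂`)
and `P₂` along the second (`u → t` on the pivotal line, then `t → w'`); in an even unit the roles are
interchanged ("after every `B₂` term the two factors `τ_p` and `τ̃_p` of `B₁` interchange top and bottom
position"). [cite: HeydenreichVanDerHofstad2017, §7.5.2 (after (7.5.20))] -/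
def unitT (d : ℕ) (odd : Bool) :
    List ((Site d × Site d → Site d × Site d → ℝ≥0∞) × (Site d × Site d → Site d) × (Site d × Site d → Site d)) :=
  if odd then [(kB1 d, rd1, rd2), (kB2 d, rd2, rd1)] else [(kB1 d, rd2, rd1), (kB2 d, rd1, rd2)]

/-- The units `i₀+1, …, i₀+k` (unit `i` is odd iff `i` is odd). [cite: HeydenreichVanDerHofstad2017, (7.4.10)] -/
def blocksFrom (d : ℕ) (i₀ : ℕ) : ℕ →
    List ((Site d × Site d → Site d × Site d → ℝ≥0∞) × (Site d × Site d → Site d) × (Site d × Site d → Site d))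
  | 0 => []
  | k + 1 => unitT d (decide ((i₀ + 1) % 2 = 1)) ++ blocksFrom d (i₀ + 1) k

/-- The last `B₁` (unit `N+1`) with its readers. [cite: HeydenreichVanDerHofstad2017, (7.4.10)] -/
def finalT (d : ℕ) (n : ℕ) :
    (Site d × Site d → Site d × Site d → ℝ≥0∞) × (Site d × Site d → Site d) × (Site d × Site d → Site d) :=
  if (n + 1) % 2 = 1 then (kB1 d, rd1, rd2) else (kB1 d, rd2, rd1)

/-- The lines into `x` (`A₃(z,t,x)` as the kernel into `(x,x)`) with the readers (both read `x` on the
diagonal). [cite: HeydenreichVanDerHofstad2017, (7.4.10)] -/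
def endT (d : ℕ) (n : ℕ) :
    (Site d × Site d → Site d × Site d → ℝ≥0∞) × (Site d × Site d → Site d) × (Site d × Site d → Site d) :=
  if (n + 1) % 2 = 1 then (kEndW d 0 0, rd1, rd2) else (kEndW d 0 0, rd2, rd1)

/-- The lines out of `0` (`A₃(0,u,w)` as the kernel from `(0,0)`): `P₁` starts along `0 → w₀`, `P₂` along
`0 → u₀`. [cite: HeydenreichVanDerHofstad2017, (7.5.5)] -/
def startT (d : ℕ) :
    (Site d × Site d → Site d × Site d → ℝ≥0∞) × (Site d × Site d → Site d) × (Site d × Site d → Site d) :=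
  (kStartW d 0 0, rd1, rd2)

/-- **The diagram of `Π^{(N+1)}` as a list of kernels with the readers of both paths.**
[cite: HeydenreichVanDerHofstad2017, (7.4.10) and §7.5.2] -/
def masterT (d : ℕ) (n : ℕ) :
    List ((Site d × Site d → Site d × Site d → ℝ≥0∞) × (Site d × Site d → Site d) × (Site d × Site d → Site d)) :=
  startT d :: (blocksFrom d 0 n ++ [finalT d n, endT d n])

/-- The kernels of the units are `B₁, B₂, B₁, B₂, …` whatever the parities. [folklore] -/
theorem map_fst_blocksFrom (i₀ k : ℕ) :
    (blocksFrom d i₀ k).map (·.1) = (List.replicate k [kB1 d, kB2 d]).flatten := by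
  induction k generalizing i₀ with
  | zero => rfl
  | succ k ih =>
    rw [blocksFrom, List.map_append, ih, List.replicate_succ, List.flatten_cons]
    congr 1
    unfold unitT
    split <;> rfl

/-- `k` units have `2k` kernels. [folklore] -/
theorem length_blocksFrom (i₀ k : ℕ) : (blocksFrom d i₀ k).length = 2 * k := by
  induction k generalizing i₀ with
  | zero => rfl
  | succ k ih =>
    rw [blocksFrom, List.length_append, ih]
    unfold unitT
    split <;> simp <;> ring

/-- **The kernels of the master list are those of the fine chain from `δ₀` to the diagonal.**
[cite: HeydenreichVanDerHofstad2017, (7.4.10)] -/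
theorem kernelsOf_masterT (n : ℕ) :
    kernelsOf ((masterT d n).map toΦ) = kStartW d 0 0 :: (kFine d n ++ [kEndW d 0 0]) := by
  rw [kernelsOf, List.map_map, show (Prod.fst ∘ toΦ) = fun x :
      (Site d × Site d → Site d × Site d → ℝ≥0∞) × (Site d × Site d → Site d) × (Site d × Site d → Site d) => x.1
      from rfl, masterT, List.map_cons, List.map_append, map_fst_blocksFrom, kFine, List.append_assoc]
  congr 2
  by_cases h : (n + 1) % 2 = 1 <;> simp [finalT, endT, h]

/-- The master list of the diagram of `Π^{(n+1)}` has `2n+3 = 2N+1` kernels. [cite: Hara2008, §3.4 ("at most (2N+1) segments")] -/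
theorem length_masterT (n : ℕ) : (masterT d n).length = 2 * n + 3 := by
  rw [masterT, List.length_cons, List.length_append, length_blocksFrom]
  simp

/-- The last `Φ`-reader reads a coordinate. [folklore] -/
theorem lastReader_masterT_toΦ (n : ℕ) :
    lastReader rd1 ((masterT d n).map toΦ) = rd1 ∨ lastReader rd1 ((masterT d n).map toΦ) = rd2 := by
  rw [masterT, List.map_cons, List.map_append, lastReader_cons, lastReader, List.foldl_append]
  simp only [List.map_cons, List.map_nil, List.foldl_cons, List.foldl_nil, toΦ, endT]
  split
  · exact Or.inl rfl
  · exact Or.inr rfl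

/-- The last `Ψ`-reader reads a coordinate. [folklore] -/
theorem lastReader_masterT_toΨ (n : ℕ) :
    lastReader rd2 ((masterT d n).map toΨ) = rd1 ∨ lastReader rd2 ((masterT d n).map toΨ) = rd2 := by
  rw [masterT, List.map_cons, List.map_append, lastReader_cons, lastReader, List.foldl_append]
  simp only [List.map_cons, List.map_nil, List.foldl_cons, List.foldl_nil, toΨ, endT]
  split
  · exact Or.inr rfl
  · exact Or.inl rfl

/-- On the diagonal both coordinate readers read `x`: `δ_diag(p) f(rd p) = δ_diag(p) f(p.1)`. [folklore] -/
theorem eDiag_mul_reader (f : Site d → ℝ≥0∞) {r : Site d × Site d → Site d} (hr : r = rd1 ∨ r = rd2)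
    (p : Site d × Site d) : eDiag d p * f (r p) = eDiag d p * f p.1 := by
  by_cases h : p.1 = p.2
  · rcases hr with rfl | rfl
    · rfl
    · rw [rd2, ← h]
  · simp [eDiag, h]

/-- **The doubly weighted diagram of `Π^{(N+1)}` is dominated by the doubly marked chains** (Hara's Steps 1
and 3 on the diagrams (7.4.10) at `p_c`): with `M = 2N+1` (`N = n+1`) kernels,
`Σ_x |x|^b |x|^c [diagram of Π^{(N)}](x) ≤ K_b(M) K_c(M) [ |0|^b|0|^c Σ_x [diagram](x) + |0|^b Σ_l dm(l)
  + |0|^c Σ_j dm(j) + Σ_{j,l} dm(j,l) ]`.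
[cite: Hara2008, §3.4 (Steps 1 and 3)] [cite: HeydenreichVanDerHofstad2017, §7.5.2] -/
theorem tsum_wE_wE_piNDiagramPc_succ_le {b c : ℝ} (hb : 0 ≤ b) (hc : 0 ≤ c) (n : ℕ) :
    ∑' x : Site d, wE b x * wE c x * piNDiagramPc d (n + 1) x ≤
      jK b (2 * n + 3) * jK c (2 * n + 3) *
        (wE b (0 : Site d) * wE c (0 : Site d) *
            ∑' p, pkChainL (vDelta d) (kernelsOf ((masterT d n).map toΦ)) p * eDiag d p +
          wE b (0 : Site d) * ∑ l ∈ Finset.range (2 * n + 3),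
            ∑' p, pkChainL (vDelta d) (kernelsOf (markAt c rd2 l ((masterT d n).map toΨ))) p * eDiag d p +
          wE c (0 : Site d) * ∑ j ∈ Finset.range (2 * n + 3),
            ∑' p, pkChainL (vDelta d) (kernelsOf ((markAt₁ b rd1 j (masterT d n)).map toΨ)) p * eDiag d p +
          ∑ j ∈ Finset.range (2 * n + 3), ∑ l ∈ Finset.range (2 * n + 3),
            dmChain d b c rd1 rd2 (masterT d n) j l (eDiag d)) := by
  have h := tsum_pkChainL_two_weights_le hb hc rd1 rd2 rfl rfl (masterT d n) (eDiag d)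
  rw [length_masterT] at h
  refine le_trans (le_of_eq ?_) h
  rw [tsum_mul_piNDiagramPc_succ_eq, kernelsOf_masterT]
  refine tsum_congr fun p => ?_
  congr 1
  simp only [sub_zero]
  by_cases hp : p.1 = p.2
  · have h1 : ∀ r : Site d × Site d → Site d, (r = rd1 ∨ r = rd2) → r p = p.1 := by
      rintro r (rfl | rfl)
      · rfl
      · exact hp.symm
    rw [h1 _ (lastReader_masterT_toΦ n), h1 _ (lastReader_masterT_toΨ n)]
  · simp [eDiag, hp]

end Master

end Literature.Barriers.CriticalPhenomena
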